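import Literature.NumberTheory.Sieve.PrimeArithmeticProgressions
import HarnessLib

/-!
# Green–Tao 2010, Example 6: three-term progressions of primes with common difference `p + 1`

Topic `Literature/NumberTheory/Sieve`. Source: B. Green, T. Tao, *Linear equations in primes*,
Ann. of Math. 171 (2010), §1 (arXiv:math/0606088 p. 7):

> **Example 6 (APs of length 3 with common difference `p ± 1`).** The number of triples of primes
> `p₁ < p₂ < p₃ ≤ N` in arithmetic progression, in which the common difference `p₂ − p₁` is equal
> to a prime plus `1`, is `(1 + o(1)) 𝔖₂ N² log^{-4} N`, where
> `𝔖₂ := ∏_{p ≥ 3} (1 − (p² − 4p + 1)/(p − 1)⁴) ≈ 1.0481`. The same asymptotic holds for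
> progressions in which `p₂ − p₁` is a prime minus `1`. This follows from a similar application
> of Corollary 1.7 [the Main Theorem] as in Example 5.

(Examples 1: "the system `(n₁, n₂, n₁ + n₂ − 1, n₁ + 2n₂ − 2)`, which counts progressions of
primes of length three whose difference `n₂ − 1` is one less than a prime, has complexity `2`.")

Kernel form (the "prime plus 1" case). With `n₁ = p₁` and `n₂ = q` the prime such that the
difference is `q + 1`, the system is `apPrimeDiffSystem = (n₁, n₂, n₁ + n₂ + 1, n₁ + 2n₂ + 2)`
(`4` forms in `2` variables, complexity `≤ 2` by Lemma 1.6: `complexity_apPrimeDiffSystem_le`); the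
count of such triples up to `N` is the prime-point count on the triangle
`{1 ≤ n₁, 1 ≤ n₂, n₁ + 2n₂ ≤ N − 2} = apRegion 3 (N − 2)` (`primeAPPrimeDiffCount_eq`), whose
archimedean factor is `(N − 5)²/4` (`archFactor_apPrimeDiffSystem`); the local factors are
`β_p = p²((p−2)² + 1)/(p−1)⁴` at EVERY prime (`localFactor_apPrimeDiffSystem`: the residues
`(x, y) ∈ 𝔽_p²` with `x, y, x+y+1, x+2y+2 ≠ 0` number `(p−2)² + 1`), i.e. `β₂ = 4` and
`β_p = 1 − (p² − 4p + 1)/(p−1)⁴` for `p ≥ 3` (`localFactor_apPrimeDiffSystem_two/_odd`), so that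
`¼ ∏_p β_p = 𝔖₂`. **Example 6** then follows from the Main Theorem at complexity `2`
(`GreenTao2010_example6_of_mainTheorem`), hence from the named facts `GITwo`, `MNTwo`
(Green–Tao's inverse `U³` theorem and Möbius–nilsequences estimate, hypotheses of the tree's
`GreenTao2010_mainTheoremAtComplexity_two_of_GI_of_MN`): `GreenTao2010_example6_of_GI_of_MN`,
`|#{…} − ¼ ∏_p β_p · N²/log⁴ N| ≤ ε N²/log⁴ N` for `N ≥ N₀(ε)`.

## References

* [GreenTao2010] B. Green, T. Tao, *Linear equations in primes*, Ann. of Math. (2) 171 (2010),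
  §1 Examples 1 and 6, (1.4), (1.6), (1.8), Lemma 1.6.
-/

noncomputable section

open MeasureTheory Set Finset
open Literature.Barriers.Parity

namespace Literature.NumberTheory.Sieve

/-! ### The system -/

/-- `(n₁, n₂, n₁ + n₂ + 1, n₁ + 2n₂ + 2)`: first prime `n₁`, the prime `n₂` with common
difference `n₂ + 1`, and the other two terms of the progression. [cite: GreenTao2010, Examples 1 and 6] -/
def apPrimeDiffSystem : Fin 4 → AffLinForm 2 :=
  ![⟨![1, 0], 0⟩, ⟨![0, 1], 0⟩, ⟨![1, 1], 1⟩, ⟨![1, 2], 2⟩]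

/-- [folklore] -/
private theorem forall_fin_four {P : Fin 4 → Prop} : (∀ i, P i) ↔ P 0 ∧ P 1 ∧ P 2 ∧ P 3 :=
  ⟨fun h => ⟨h 0, h 1, h 2, h 3⟩, fun h i => by
    fin_cases i
    exacts [h.1, h.2.1, h.2.2.1, h.2.2.2]⟩

/-- The four values `ψᵢ(n)`. [cite: GreenTao2010, Examples 1] -/
theorem forall_eval_apPrimeDiffSystem {P : ℤ → Prop} (n : Fin 2 → ℤ) :
    (∀ i, P ((apPrimeDiffSystem i).eval n)) ↔
      P (n 0) ∧ P (n 1) ∧ P (n 0 + n 1 + 1) ∧ P (n 0 + 2 * n 1 + 2) := by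
  rw [forall_fin_four]
  simp [apPrimeDiffSystem, AffLinForm.eval, Fin.sum_univ_two]

/-- The four values `ψᵢ(v)` modulo `p`. [cite: GreenTao2010, (1.6)] -/
theorem forall_modEval_apPrimeDiffSystem {p : ℕ} {P : ZMod p → Prop} (v : Fin 2 → ZMod p) :
    (∀ i, P ((apPrimeDiffSystem i).modEval p v)) ↔
      P (v 0) ∧ P (v 1) ∧ P (v 0 + v 1 + 1) ∧ P (v 0 + 2 * v 1 + 2) := by
  rw [forall_fin_four]
  simp [apPrimeDiffSystem, AffLinForm.modEval, Fin.sum_univ_two]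

/-- The four values `ψᵢ(x)` over `ℝ`. [cite: GreenTao2010, (1.4)] -/
theorem forall_realEval_apPrimeDiffSystem {P : ℝ → Prop} (x : Fin 2 → ℝ) :
    (∀ i, P ((apPrimeDiffSystem i).realEval x)) ↔
      P (x 0) ∧ P (x 1) ∧ P (x 0 + x 1 + 1) ∧ P (x 0 + 2 * x 1 + 2) := by
  rw [forall_fin_four]
  simp [apPrimeDiffSystem, AffLinForm.realEval, Fin.sum_univ_two]

/-- The four primality conditions. [cite: GreenTao2010, §1 Example 6] -/
theorem forall_prime_eval_apPrimeDiffSystem (n : Fin 2 → ℤ) :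
    (∀ i, ((apPrimeDiffSystem i).eval n).toNat.Prime) ↔
      (n 0).toNat.Prime ∧ (n 1).toNat.Prime ∧ (n 0 + n 1 + 1).toNat.Prime ∧
        (n 0 + 2 * n 1 + 2).toNat.Prime :=
  forall_eval_apPrimeDiffSystem (P := fun z => z.toNat.Prime) n

/-- The four non-divisibility conditions. [cite: GreenTao2010, Cor. 1.9] -/
theorem forall_not_dvd_eval_apPrimeDiffSystem (p : ℤ) (n : Fin 2 → ℤ) :
    (∀ i, ¬ (p ∣ (apPrimeDiffSystem i).eval n)) ↔
      ¬ (p ∣ n 0) ∧ ¬ (p ∣ n 1) ∧ ¬ (p ∣ n 0 + n 1 + 1) ∧ ¬ (p ∣ n 0 + 2 * n 1 + 2) :=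
  forall_eval_apPrimeDiffSystem (P := fun z => ¬ (p ∣ z)) n

/-- The four good-residue conditions. [cite: GreenTao2010, (1.6)] -/
theorem forall_modEval_ne_zero_apPrimeDiffSystem {p : ℕ} (v : Fin 2 → ZMod p) :
    (∀ i, ¬ (apPrimeDiffSystem i).modEval p v = 0) ↔
      v 0 ≠ 0 ∧ v 1 ≠ 0 ∧ v 0 + v 1 + 1 ≠ 0 ∧ v 0 + 2 * v 1 + 2 ≠ 0 :=
  forall_modEval_apPrimeDiffSystem (P := fun z => ¬ z = 0) v

/-- The four positivity conditions. [cite: GreenTao2010, (1.4)] -/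
theorem forall_realEval_pos_apPrimeDiffSystem (x : Fin 2 → ℝ) :
    (∀ i, 0 < (apPrimeDiffSystem i).realEval x) ↔
      0 < x 0 ∧ 0 < x 1 ∧ 0 < x 0 + x 1 + 1 ∧ 0 < x 0 + 2 * x 1 + 2 :=
  forall_realEval_apPrimeDiffSystem (P := fun z => 0 < z) x

/-- No two linear parts `(1,0), (0,1), (1,1), (1,2)` are parallel. [cite: GreenTao2010, Examples 1] -/
theorem isFiniteComplexitySystem_apPrimeDiffSystem : IsFiniteComplexitySystem apPrimeDiffSystem := by
  intro i j hij a b hab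
  have h0 := congr_fun hab 0
  have h1 := congr_fun hab 1
  simp only [Pi.smul_apply, smul_eq_mul] at h0 h1
  clear hab
  fin_cases i <;> fin_cases j <;> first
    | exact absurd rfl hij
    | (simp [apPrimeDiffSystem] at h0 h1; omega)

/-- No form is constant. [cite: GreenTao2010, Def. 1.1] -/
theorem coeff_apPrimeDiffSystem_ne_zero (i : Fin 4) : (apPrimeDiffSystem i).coeff ≠ 0 := by
  intro h
  have h0 := congr_fun h 0
  have h1 := congr_fun h 1
  fin_cases i <;> simp_all [apPrimeDiffSystem]

/-- **Complexity at most `2`** (four pairwise independent forms; Lemma 1.6: complexity `≤ t − 2`).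
Green–Tao (Examples 1) note it is exactly `2`. [cite: GreenTao2010, Examples 1 and Lemma 1.6] -/
theorem complexity_apPrimeDiffSystem_le : complexity apPrimeDiffSystem ≤ (2 : ℕ) :=
  complexity_le_of_isFiniteComplexitySystem isFiniteComplexitySystem_apPrimeDiffSystem
    coeff_apPrimeDiffSystem_ne_zero

/-- Hence the standing hypotheses hold. [cite: GreenTao2010, Def. 1.1] -/
theorem isNondegenerateSystem_apPrimeDiffSystem : IsNondegenerateSystem apPrimeDiffSystem :=
  isNondegenerateSystem_of_complexity_le complexity_apPrimeDiffSystem_le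

/-- `‖Ψ‖_N = 7 + 3/N ≤ 10` for `N ≥ 1`. [cite: GreenTao2010, (1.1)] -/
theorem affLinSize_apPrimeDiffSystem_le {N : ℝ} (hN : 1 ≤ N) :
    affLinSize apPrimeDiffSystem N ≤ ((10 : ℕ) : ℝ) := by
  unfold affLinSize
  simp only [Fin.sum_univ_four, Fin.sum_univ_two, apPrimeDiffSystem, Matrix.cons_val_zero,
    Matrix.cons_val_one, Matrix.cons_val]
  norm_num [abs_div, abs_of_pos (lt_of_lt_of_le one_pos hN)]
  have h1 : N⁻¹ ≤ 1 := inv_le_one_of_one_le₀ hN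
  have h2 : 2 / N ≤ 2 := by rw [div_le_iff₀ (by linarith)]; linarith
  linarith

/-! ### The count -/

/-- **The number of triples of primes `p₁ < p₂ < p₃ ≤ N` in arithmetic progression whose common
difference is a prime plus `1`**, parametrised by `(p₁, q)` with difference `q + 1`:
`#{(a, q) : a, q ≥ 1, a + 2q + 2 ≤ N, a, q, a + q + 1, a + 2q + 2 prime}`.
[cite: GreenTao2010, §1 Example 6] -/
def primeAPPrimeDiffCount (N : ℕ) : ℕ :=
  #((range (N + 1) ×ˢ range (N + 1)).filter fun q =>
      1 ≤ q.1 ∧ 1 ≤ q.2 ∧ q.1 + 2 * q.2 + 2 ≤ N ∧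
        q.1.Prime ∧ q.2.Prime ∧ (q.1 + q.2 + 1).Prime ∧ (q.1 + 2 * q.2 + 2).Prime)

/-- [folklore] -/
private theorem mem_latticeBox_two {N : ℕ} {n : Fin 2 → ℤ} :
    n ∈ latticeBox 2 N ↔ (-(N : ℤ) ≤ n 0 ∧ n 0 ≤ N) ∧ (-(N : ℤ) ≤ n 1 ∧ n 1 ≤ N) := by
  unfold latticeBox
  rw [Fintype.mem_piFinset, Fin.forall_fin_two, Finset.mem_Icc, Finset.mem_Icc]

/-- [folklore] -/
private theorem realPoint_mem_apRegion_three {M : ℕ} {n : Fin 2 → ℤ} :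
    realPoint n ∈ apRegion 3 M ↔ 1 ≤ n 0 ∧ 1 ≤ n 1 ∧ n 0 + 2 * n 1 ≤ M := by
  simp only [apRegion, realPoint, Set.mem_setOf_eq]
  norm_num
  refine ⟨fun ⟨h0, h1, h2⟩ => ⟨by exact_mod_cast h0, by exact_mod_cast h1, by exact_mod_cast h2⟩,
    fun ⟨h0, h1, h2⟩ => ⟨by exact_mod_cast h0, by exact_mod_cast h1, by exact_mod_cast h2⟩⟩

/-- **The count is the prime-point count of the system on the triangle
`{1 ≤ n₁, 1 ≤ n₂, n₁ + 2n₂ ≤ N − 2}`.** [cite: GreenTao2010, §1 Example 6, (1.8)] -/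
theorem primeAPPrimeDiffCount_eq (N : ℕ) :
    primeAPPrimeDiffCount N = primePointCount apPrimeDiffSystem (apRegion 3 (N - 2)) N := by
  classical
  unfold primeAPPrimeDiffCount primePointCount
  refine Finset.card_nbij' (fun q => ![(q.1 : ℤ), (q.2 : ℤ)])
    (fun n => ((n 0).toNat, (n 1).toNat)) ?_ ?_ ?_ ?_
  · intro q hq
    rw [Finset.mem_coe, Finset.mem_filter, Finset.mem_product, Finset.mem_range,
      Finset.mem_range] at hq
    obtain ⟨⟨ha, hb⟩, ha1, hb1, hc, hp0, hp1, hp2, hp3⟩ := hq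
    rw [Finset.mem_coe, Finset.mem_filter, mem_latticeBox_two, realPoint_mem_apRegion_three,
      forall_prime_eval_apPrimeDiffSystem]
    simp only [Matrix.cons_val_zero, Matrix.cons_val_one]
    refine ⟨⟨⟨by omega, by omega⟩, by omega, by omega⟩,
      ⟨by exact_mod_cast ha1, by exact_mod_cast hb1, by omega⟩, ?_, ?_, ?_, ?_⟩
    · simpa using hp0
    · simpa using hp1
    · rw [show (q.1 : ℤ) + q.2 + 1 = ((q.1 + q.2 + 1 : ℕ) : ℤ) by push_cast; ring, Int.toNat_natCast]
      exact hp2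
    · rw [show (q.1 : ℤ) + 2 * q.2 + 2 = ((q.1 + 2 * q.2 + 2 : ℕ) : ℤ) by push_cast; ring,
        Int.toNat_natCast]
      exact hp3
  · intro n hn
    rw [Finset.mem_coe, Finset.mem_filter, mem_latticeBox_two, realPoint_mem_apRegion_three,
      forall_prime_eval_apPrimeDiffSystem] at hn
    obtain ⟨⟨⟨-, hA⟩, -, hB⟩, ⟨h0, h1, h2⟩, hp0, hp1, hp2, hp3⟩ := hn
    obtain ⟨A, hA'⟩ := Int.eq_ofNat_of_zero_le (by omega : (0 : ℤ) ≤ n 0)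
    obtain ⟨B, hB'⟩ := Int.eq_ofNat_of_zero_le (by omega : (0 : ℤ) ≤ n 1)
    simp only [hA', hB', Int.toNat_natCast] at hp0 hp1 hp2 hp3 ⊢
    rw [hA'] at hA h0 h2
    rw [hB'] at hB h1 h2
    rw [Finset.mem_coe, Finset.mem_filter, Finset.mem_product, Finset.mem_range, Finset.mem_range]
    refine ⟨⟨by omega, by omega⟩, by exact_mod_cast h0, by exact_mod_cast h1, ?_, hp0, hp1, ?_, ?_⟩
    · have : ((A + 2 * B : ℕ) : ℤ) ≤ ((N - 2 : ℕ) : ℤ) := by push_cast; exact h2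
      have := Int.ofNat_le.mp this
      omega
    · rwa [show (A : ℤ) + B + 1 = ((A + B + 1 : ℕ) : ℤ) by push_cast; ring,
        Int.toNat_natCast] at hp2
    · rwa [show (A : ℤ) + 2 * B + 2 = ((A + 2 * B + 2 : ℕ) : ℤ) by push_cast; ring,
        Int.toNat_natCast] at hp3
  · intro q hq
    simp
  · intro n hn
    rw [Finset.mem_coe, Finset.mem_filter, realPoint_mem_apRegion_three] at hn
    obtain ⟨-, ⟨h0, h1, -⟩, -⟩ := hn
    funext j
    fin_cases j
    · simp; omega
    · simp; omega

/-! ### The local factors -/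

/-- [folklore] -/
private theorem zmod_two_dichotomy : ∀ y : ZMod 2, y = 0 ∨ y + 1 = 0 := by decide

/-- The fibres of the good residues: for `y ≠ 0`, the `x ∈ 𝔽_p` with `x, x+y+1, x+2y+2 ≠ 0`
number `p − 1` if `y = −1` (only `x = 0` is excluded) and `p − 3` otherwise (`0, −(y+1),
−2(y+1)` are excluded and distinct). [cite: GreenTao2010, §1 Example 6] -/
theorem card_apPrimeDiff_fibre {p : ℕ} [hp : Fact p.Prime] {y : ZMod p} (hy : y ≠ 0) :
    #{x : ZMod p | x ≠ 0 ∧ x + y + 1 ≠ 0 ∧ x + 2 * y + 2 ≠ 0} =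
      if y + 1 = 0 then p - 1 else p - 3 := by
  classical
  have hbad : (Finset.univ.filter fun x : ZMod p => ¬ (x ≠ 0 ∧ x + y + 1 ≠ 0 ∧ x + 2 * y + 2 ≠ 0)) =
      {0, -(y + 1), -(2 * (y + 1))} := by
    ext x
    simp only [Finset.mem_filter, Finset.mem_univ, true_and, not_and_or, not_not,
      Finset.mem_insert, Finset.mem_singleton]
    constructor
    · rintro (h | h | h)
      · exact Or.inl h
      · exact Or.inr (Or.inl (by linear_combination h))
      · exact Or.inr (Or.inr (by linear_combination h))
    · rintro (rfl | rfl | rfl)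
      · exact Or.inl rfl
      · exact Or.inr (Or.inl (by ring))
      · exact Or.inr (Or.inr (by ring))
  have hcount := Finset.card_filter_add_card_filter_not (s := (Finset.univ : Finset (ZMod p)))
    (fun x => x ≠ 0 ∧ x + y + 1 ≠ 0 ∧ x + 2 * y + 2 ≠ 0)
  rw [hbad, Finset.card_univ, ZMod.card] at hcount
  split_ifs with hy1
  · have : ({0, -(y + 1), -(2 * (y + 1))} : Finset (ZMod p)) = {0} := by
      rw [hy1]; simp
    rw [this, Finset.card_singleton] at hcount
    omega
  · have h2 : (2 : ZMod p) ≠ 0 := by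
      intro h2
      have h' : ((2 : ℕ) : ZMod p) = 0 := by exact_mod_cast h2
      rw [ZMod.natCast_eq_zero_iff] at h'
      have hp2 : p = 2 := ((Nat.prime_dvd_prime_iff_eq hp.out Nat.prime_two).mp h').symm ▸ rfl
      subst hp2
      rcases zmod_two_dichotomy y with h | h
      · exact hy h
      · exact hy1 h
    have ha : (0 : ZMod p) ∉ ({-(y + 1), -(2 * (y + 1))} : Finset (ZMod p)) := by
      simp only [Finset.mem_insert, Finset.mem_singleton, not_or]
      refine ⟨fun h => hy1 ?_, fun h => hy1 ?_⟩
      · linear_combination h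
      · have h' : (2 : ZMod p) * (y + 1) = 0 := by linear_combination h
        exact (mul_eq_zero.mp h').resolve_left h2
    have hb : -(y + 1) ≠ -(2 * (y + 1)) := by
      intro h
      apply hy1
      linear_combination h
    rw [Finset.card_insert_of_notMem ha, Finset.card_pair hb] at hcount
    omega

/-- **The good residues number `(p − 2)² + 1`** at every prime: summing the fibres over
`y ≠ 0` gives `(p − 1) + (p − 2)(p − 3)`. [cite: GreenTao2010, §1 Example 6, (1.6)] -/
theorem goodCount_apPrimeDiffSystem {p : ℕ} [hp : Fact p.Prime] :
    goodCount apPrimeDiffSystem p = (p - 1) + (p - 2) * (p - 3) := by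
  classical
  have hgood : goodCount apPrimeDiffSystem p =
      #{q : ZMod p × ZMod p | q.1 ≠ 0 ∧ q.2 ≠ 0 ∧ q.1 + q.2 + 1 ≠ 0 ∧ q.1 + 2 * q.2 + 2 ≠ 0} := by
    unfold goodCount
    refine Finset.card_equiv (finTwoArrowEquiv (ZMod p)) fun v => ?_
    simp only [Finset.mem_filter, Finset.mem_univ, true_and,
      forall_modEval_ne_zero_apPrimeDiffSystem]
    simp
  rw [hgood, Finset.card_filter, Fintype.sum_prod_type_right]
  have hfib : ∀ y : ZMod p,
      (∑ x : ZMod p, if (x ≠ 0 ∧ y ≠ 0 ∧ x + y + 1 ≠ 0 ∧ x + 2 * y + 2 ≠ 0) then 1 else 0) =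
        (if y + 1 = 0 then p - 1 else 0) + (if (y ≠ 0 ∧ y + 1 ≠ 0) then p - 3 else 0) := by
    intro y
    by_cases hy : y = 0
    · have h1 : y + 1 ≠ 0 := by rw [hy, zero_add]; exact one_ne_zero
      simp [hy]
    · have e : ∀ x : ZMod p, (if (x ≠ 0 ∧ y ≠ 0 ∧ x + y + 1 ≠ 0 ∧ x + 2 * y + 2 ≠ 0) then 1 else 0)
          = if (x ≠ 0 ∧ x + y + 1 ≠ 0 ∧ x + 2 * y + 2 ≠ 0) then 1 else 0 := by
        intro x; simp [hy]
      simp_rw [e]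
      rw [← Finset.card_filter, card_apPrimeDiff_fibre hy]
      by_cases hy1 : y + 1 = 0
      · simp [hy1, hy]
      · simp [hy1, hy]
  simp_rw [hfib]
  rw [Finset.sum_add_distrib, Finset.sum_ite, Finset.sum_const_zero, add_zero, Finset.sum_const,
    Finset.sum_ite, Finset.sum_const_zero, add_zero, Finset.sum_const, smul_eq_mul, smul_eq_mul]
  have hc1 : #(Finset.univ.filter fun y : ZMod p => y + 1 = 0) = 1 := by
    rw [Finset.card_eq_one]
    refine ⟨-1, ?_⟩
    ext y
    simp only [Finset.mem_filter, Finset.mem_univ, true_and, Finset.mem_singleton]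
    constructor
    · intro h; linear_combination h
    · rintro rfl; ring
  have hc2 : #(Finset.univ.filter fun y : ZMod p => y ≠ 0 ∧ y + 1 ≠ 0) = p - 2 := by
    have hbad : (Finset.univ.filter fun y : ZMod p => ¬ (y ≠ 0 ∧ y + 1 ≠ 0)) = {0, -1} := by
      ext y
      simp only [Finset.mem_filter, Finset.mem_univ, true_and, not_and_or, not_not,
        Finset.mem_insert, Finset.mem_singleton]
      constructor
      · rintro (h | h)
        · exact Or.inl h
        · exact Or.inr (by linear_combination h)
      · rintro (rfl | rfl)
        · exact Or.inl rfl
        · exact Or.inr (by ring)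
    have hcount := Finset.card_filter_add_card_filter_not (s := (Finset.univ : Finset (ZMod p)))
      (fun y => y ≠ 0 ∧ y + 1 ≠ 0)
    have hne : (0 : ZMod p) ≠ -1 := fun h => one_ne_zero (by linear_combination h)
    rw [hbad, Finset.card_pair hne, Finset.card_univ, ZMod.card] at hcount
    omega
  rw [hc1, hc2, one_mul]

/-- Green–Tao's `β_p` for Example 6, in closed form valid at every prime:
`β_p = p² ((p−2)² + 1)/(p−1)⁴`. [cite: GreenTao2010, §1 Example 6] -/
def apPrimeDiffLocalFactor (p : ℕ) : ℝ := (p : ℝ) ^ 2 * (((p : ℝ) - 2) ^ 2 + 1) / ((p : ℝ) - 1) ^ 4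

/-- **`β_p` of the system** at every prime. [cite: GreenTao2010, §1 Example 6, (1.6)] -/
theorem localFactor_apPrimeDiffSystem {p : ℕ} (hp : p.Prime) :
    localFactor apPrimeDiffSystem p = apPrimeDiffLocalFactor p := by
  classical
  haveI := Fact.mk hp
  have hp0 : (p : ℝ) ≠ 0 := by exact_mod_cast hp.ne_zero
  have hp1 : (p : ℝ) - 1 ≠ 0 := by
    have : (2 : ℝ) ≤ p := by exact_mod_cast hp.two_le
    linarith
  have hcast : (((p - 1) + (p - 2) * (p - 3) : ℕ) : ℝ) = ((p : ℝ) - 2) ^ 2 + 1 := by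
    rcases Nat.lt_or_ge p 3 with h3 | h3
    · have h2 : p = 2 := by have := hp.two_le; omega
      subst h2
      norm_num
    · rw [Nat.cast_add, Nat.cast_mul, Nat.cast_sub hp.one_le, Nat.cast_sub hp.two_le,
        Nat.cast_sub h3]
      push_cast
      ring
  rw [localFactor_prime, goodCount_apPrimeDiffSystem, hcast]
  unfold apPrimeDiffLocalFactor
  field_simp

/-- `β₂ = 4`. [cite: GreenTao2010, §1 Example 6] -/
theorem localFactor_apPrimeDiffSystem_two : localFactor apPrimeDiffSystem 2 = 4 := by
  rw [localFactor_apPrimeDiffSystem Nat.prime_two]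
  unfold apPrimeDiffLocalFactor
  norm_num

/-- Green–Tao's printed form `β_p = 1 − (p² − 4p + 1)/(p − 1)⁴` (stated for `p ≥ 3`; it also
holds at `p = 2`, where it equals `4`). [cite: GreenTao2010, §1 Example 6] -/
theorem localFactor_apPrimeDiffSystem_eq {p : ℕ} (hp : p.Prime) :
    localFactor apPrimeDiffSystem p = 1 - ((p : ℝ) ^ 2 - 4 * p + 1) / ((p : ℝ) - 1) ^ 4 := by
  rw [localFactor_apPrimeDiffSystem hp]
  unfold apPrimeDiffLocalFactor
  have hp1 : (p : ℝ) - 1 ≠ 0 := by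
    have : (2 : ℝ) ≤ p := by exact_mod_cast hp.two_le
    linarith
  field_simp
  ring

/-- The partial singular products are the Euler factors of `4 𝔖₂`.
[cite: GreenTao2010, §1 Example 6] -/
theorem singularProductPartial_apPrimeDiffSystem (x : ℕ) :
    singularProductPartial apPrimeDiffSystem x = ∏ p ∈ Nat.primesLE x, apPrimeDiffLocalFactor p := by
  unfold singularProductPartial
  exact Finset.prod_congr rfl fun p hp => localFactor_apPrimeDiffSystem (Nat.prime_of_mem_primesLE hp)

/-- [folklore] -/
private theorem not_natCast_dvd_one {p : ℕ} (hp : p.Prime) : ¬ (p : ℤ) ∣ 1 := by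
  intro h
  exact hp.one_lt.ne' (Nat.dvd_one.mp (Int.natCast_dvd_natCast.mp (by exact_mod_cast h)))

/-- No local obstruction (witness `n = (−1, −1)`: all four forms equal `−1`).
[cite: GreenTao2010, Cor. 1.9, §1 Example 6] -/
theorem apPrimeDiffSystem_locallySolvable (p : ℕ) (hp : p.Prime) :
    ∃ n : Fin 2 → ℤ, ∀ i, ¬ ((p : ℤ) ∣ (apPrimeDiffSystem i).eval n) := by
  refine ⟨![-1, -1], ?_⟩
  rw [forall_not_dvd_eval_apPrimeDiffSystem]
  simp only [Matrix.cons_val_zero, Matrix.cons_val_one]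
  norm_num
  exact not_natCast_dvd_one hp

/-- `∏_p β_p > 0`. [cite: GreenTao2010, Cor. 1.9, §1 Example 6] -/
theorem singularProduct_apPrimeDiffSystem_pos : 0 < singularProduct apPrimeDiffSystem :=
  singularProduct_pos_of_locallySolvable _ isNondegenerateSystem_apPrimeDiffSystem
    apPrimeDiffSystem_locallySolvable

/-! ### The archimedean factor -/

/-- On the triangle `{1 ≤ x, 1 ≤ y, x + 2y ≤ M}` all four forms are positive, so `β_∞` is the
area `(M − 3)²/4` of the triangle (the tree's `archFactor_apSystem` at `k = 3`).
[cite: GreenTao2010, (1.4), §1 Example 6] -/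
theorem archFactor_apPrimeDiffSystem {M : ℕ} (hM : 3 ≤ M) :
    archFactor apPrimeDiffSystem (apRegion 3 M) = ((M : ℝ) - 3) ^ 2 / 4 := by
  have hset : apRegion 3 M ∩ {x | ∀ i, 0 < (apPrimeDiffSystem i).realEval x} =
      apRegion 3 M ∩ {x | ∀ i, 0 < (apSystem 3 i).realEval x} := by
    ext x
    constructor
    · rintro ⟨hx, -⟩
      exact ⟨hx, fun i => realEval_apSystem_pos hx i⟩
    · rintro ⟨hx, -⟩
      refine ⟨hx, ?_⟩
      rw [Set.mem_setOf_eq, forall_realEval_pos_apPrimeDiffSystem]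
      obtain ⟨h0, h1, -⟩ := hx
      exact ⟨by linarith, by linarith, by linarith, by linarith⟩
  have h3 := archFactor_apSystem (k := 3) (by norm_num) hM
  unfold archFactor at h3 ⊢
  rw [hset, h3]
  norm_num

/-! ### Example 6 from the Main Theorem at complexity `2` -/

/-- **Green–Tao 2010, Example 6, from the Main Theorem at complexity `2`.** For every `ε > 0`
and `N ≥ N₀(ε)`: `|#{p₁ < p₂ < p₃ ≤ N primes in AP, p₂ − p₁ − 1 prime} − ¼ ∏_p β_p · N²/log⁴ N|
≤ ε N²/log⁴ N`, where `¼ ∏_p β_p = ∏_{p ≥ 3} (1 − (p² − 4p + 1)/(p−1)⁴) = 𝔖₂`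
(`localFactor_apPrimeDiffSystem_two/_eq`). [cite: GreenTao2010, §1 Example 6] -/
theorem GreenTao2010_example6_of_mainTheorem (h : GreenTao2010_mainTheoremAtComplexity 2) :
    ∀ ε : ℝ, 0 < ε → ∃ N₀ : ℕ, ∀ N : ℕ, N₀ ≤ N →
      |(primeAPPrimeDiffCount N : ℝ) -
          1 / 4 * singularProduct apPrimeDiffSystem * (N : ℝ) ^ 2 / Real.log N ^ 4| ≤
        ε * (N : ℝ) ^ 2 / Real.log N ^ 4 := by
  intro ε hε
  have hS0 := singularProduct_apPrimeDiffSystem_pos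
  set S : ℝ := singularProduct apPrimeDiffSystem with hS
  set ε' : ℝ := ε / (2 * (S / 4 + 1)) with hε'
  have hε'0 : 0 < ε' := by positivity
  obtain ⟨N₁, hN₁⟩ := GreenTao2010_primePointCount_of_mainTheoremAtComplexity h 2 4 10
    (by norm_num) (by norm_num) ε' hε'0
  refine ⟨max (max N₁ 5) ⌈6 * S / ε⌉₊, fun N hN => ?_⟩
  have hN1 : N₁ ≤ N := le_trans (le_trans (le_max_left _ _) (le_max_left _ _)) hN
  have hN5 : 5 ≤ N := le_trans (le_trans (le_max_right _ _) (le_max_left _ _)) hN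
  have hNc : ⌈6 * S / ε⌉₊ ≤ N := le_trans (le_max_right _ _) hN
  have hNε : 6 * S ≤ ε * N := by
    have h' := le_trans (Nat.le_ceil (6 * S / ε))
      (show (⌈6 * S / ε⌉₊ : ℝ) ≤ N by exact_mod_cast hNc)
    rw [div_le_iff₀ hε] at h'
    linarith
  have hNr : (5 : ℝ) ≤ N := by exact_mod_cast hN5
  have hL : 0 < Real.log N ^ 4 := pow_pos (Real.log_pos (by linarith)) _
  have hsub : apRegion 3 (N - 2) ⊆ realBox 2 (N : ℝ) :=
    (apRegion_subset_realBox (by norm_num) (N - 2)).trans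
      (realBox_mono 2 (by exact_mod_cast Nat.sub_le N 2))
  have key := hN₁ N hN1 apPrimeDiffSystem isNondegenerateSystem_apPrimeDiffSystem
    complexity_apPrimeDiffSystem_le (affLinSize_apPrimeDiffSystem_le (by linarith))
    (apRegion 3 (N - 2)) (convex_apRegion 3 (N - 2)) hsub
  rw [← primeAPPrimeDiffCount_eq N, archFactor_apPrimeDiffSystem (M := N - 2) (by omega),
    Nat.cast_sub (by omega : 2 ≤ N), Nat.cast_two] at key
  set P : ℝ := (primeAPPrimeDiffCount N : ℝ)
  set Lg : ℝ := Real.log N ^ 4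
  set A : ℝ := ((N : ℝ) - 2 - 3) ^ 2 / 4 with hA
  -- the main term moves by `O(N · 𝔖 / log⁴ N)`
  have hmN : ((N : ℝ) - 2 - 3) ^ 2 ≤ (N : ℝ) ^ 2 := by nlinarith
  have hdiff : |A * S / Lg - 1 / 4 * S * (N : ℝ) ^ 2 / Lg| ≤ 3 * S * N / Lg := by
    rw [← sub_div, abs_div, abs_of_pos hL]
    refine div_le_div_of_nonneg_right ?_ hL.le
    have e : A * S - 1 / 4 * S * (N : ℝ) ^ 2 = -(S * (10 * N - 25) / 4) := by
      rw [hA]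
      ring
    have hnum : 0 ≤ S * (10 * N - 25) / 4 :=
      div_nonneg (mul_nonneg hS0.le (by linarith)) (by norm_num)
    rw [e, abs_neg, abs_of_nonneg hnum, div_le_iff₀ (by norm_num)]
    nlinarith [mul_nonneg hS0.le (le_trans (by norm_num) hNr)]
  have hmain : ε' * (A * S + (N : ℝ) ^ 2) ≤ ε / 2 * (N : ℝ) ^ 2 := by
    have h1 : A * S ≤ (N : ℝ) ^ 2 / 4 * S :=
      mul_le_mul_of_nonneg_right (div_le_div_of_nonneg_right hmN (by norm_num)) hS0.le
    calc ε' * (A * S + (N : ℝ) ^ 2) ≤ ε' * ((N : ℝ) ^ 2 / 4 * S + (N : ℝ) ^ 2) := by gcongr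
      _ = ε / 2 * (N : ℝ) ^ 2 := by rw [hε']; field_simp
  have hsec : 3 * S * N ≤ ε / 2 * (N : ℝ) ^ 2 := by nlinarith
  calc |P - 1 / 4 * S * (N : ℝ) ^ 2 / Lg|
      ≤ |P - A * S / Lg| + |A * S / Lg - 1 / 4 * S * (N : ℝ) ^ 2 / Lg| := abs_sub_le _ _ _
    _ ≤ ε' * (A * S + (N : ℝ) ^ 2) / Lg + 3 * S * N / Lg := add_le_add key hdiff
    _ ≤ ε / 2 * (N : ℝ) ^ 2 / Lg + ε / 2 * (N : ℝ) ^ 2 / Lg :=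
        add_le_add (div_le_div_of_nonneg_right hmain hL.le) (div_le_div_of_nonneg_right hsec hL.le)
    _ = ε * (N : ℝ) ^ 2 / Lg := by ring

/-- **Green–Tao 2010, Example 6 (APs of length 3 with common difference `p + 1`)**, from the named
facts `GI(2)` (the inverse `U³` theorem) and `MN(2)` (Möbius is orthogonal to 2-step
nilsequences), exactly as the paper deduces it from Corollary 1.7: the number of triples of
primes `p₁ < p₂ < p₃ ≤ N` in arithmetic progression with `p₂ − p₁` a prime plus `1` is
`(𝔖₂ + o(1)) N²/log⁴ N`, `𝔖₂ = ¼ ∏_p β_p = ∏_{p≥3}(1 − (p²−4p+1)/(p−1)⁴) ≈ 1.0481`.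
[cite: GreenTao2010, §1 Example 6] -/
theorem GreenTao2010_example6_of_GI_of_MN (hGI : GreenTaoLevelTwo.GITwo)
    (hMN : GreenTaoLevelTwo.MNTwo) :
    ∀ ε : ℝ, 0 < ε → ∃ N₀ : ℕ, ∀ N : ℕ, N₀ ≤ N →
      |(primeAPPrimeDiffCount N : ℝ) -
          1 / 4 * singularProduct apPrimeDiffSystem * (N : ℝ) ^ 2 / Real.log N ^ 4| ≤
        ε * (N : ℝ) ^ 2 / Real.log N ^ 4 :=
  GreenTao2010_example6_of_mainTheorem (GreenTao2010_mainTheoremAtComplexity_two_of_GI_of_MN hGI hMN)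

end Literature.NumberTheory.Sieve

end
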